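import Literature.Computability.MetaComplexity.FunctionalPigeonholeDegree
import Literature.Computability.MetaComplexity.PolynomialCalculusRespectfulExpanderTheorem
import HarnessLib

/-!
# The Mikša–Nordström structure of the graph functional pigeonhole principle (CCC 2015, proof of Thm 4.9)

Mikša–Nordström, CCC 2015, Theorem 4.9 (arXiv:1505.01358 Thm 42): if the bipartite graph `G`
(pigeons `Fin m`, holes `Fin n`, left neighbourhoods `N`) is an `(s, δ)`-boundary expander with left
degrees `≤ d`, then `FPHP_G` has no PC refutation of degree `≤ δs/(2d)`, over any field.  This file
and `FunctionalPigeonholeDegreeProof.lean` DISCHARGE the named fact `MiksaNordstrom2015_PC_FPHP_degree`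
of `FunctionalPigeonholeDegree.lean` by building MN15's structure `(𝓕, 𝒱)_E` for `FPHP_G` (proof of
Thm 4.9; here: the structure and its expansion/overlap; there: satisfiability of small subfamilies
and the theorem): `𝓕 u = {P^u}` (the pigeon axioms as singleton subformulas, `FPHP.fam`),
`E` = hole and functionality axioms (`FPHP.fixedE`), and for every hole `v` the variable set
`V_v = {x_{u',v'} : u' ∈ N⁻¹(v), v' ∈ N(u')}` (`FPHP.vset`); then

* every `V_v` respects `E` (all-false assignment), `V_v` is a neighbour of `P^u` iff `v ∈ N(u)`, and
  then a RESPECTFUL one (send `u` to `v`, everything else in `V_v` to false: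
  `FPHP.isRespNbr_of_mem`), so boundary expansion of `G` is respectful boundary expansion of the
  structure (`FPHP.isRespExpander`); the overlap is `≤ d` (`FPHP.overlap_le`);
* small pigeon sets have system-of-distinct-representative matchings by boundary expansion, whence
  `⋀_{u ∈ S} P^u ∧ E` is satisfiable for `|S| ≤ s` (`FPHP.exists_sdr`, `FPHP.locSol_nonempty` —
  MN15 arXiv:1505.01358 Lemma 32 specialised);
* the generalised method (`MiksaNordstrom.not_refutableInDegree`, MN15 Thm 3.6) gives the bound for
  `s ≥ 2`; for `1 ≤ s < 2` the admissible degree is `0` and no axiom is usable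
  (`PC.not_refutableInDegree_of_lt_totalDegree`); `m = 0` is covered by Boolean soundness
  (`PC.not_refutableInDegree_of_model`).

Source: M. Mikša, J. Nordström, CCC 2015 (LIPIcs 33) Thm 4.9 and its proof, §4.2 = arXiv:1505.01358
Thm 42 [MiksaNordstrom2015] (held copy `paper:arxiv-1505.01358` p0023).
-/

noncomputable section

namespace Literature.Computability.MetaComplexity

open Finset MvPolynomial Literature.Computability.Complexity PCResidue MiksaNordstrom

/-! ### Two soundness facts for Krajíček's PC -/

namespace PC

variable {K : Type*} [Field K]

/-- **Boolean soundness**: a system with a common Boolean root has no PC refutation (every line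
vanishes at the root). [Galesi–Lauria 2010, §2.2 ("`g` has a PC proof from `E` iff `g(x) = 0` for
every common root")] [cite: GalesiLauria2010, §2.2] -/
theorem not_refutableInDegree_of_model {𝓕 : Set (MvPolynomial ℕ K)} {x : ℕ → Bool}
    (hx : ∀ f ∈ 𝓕, bval x f = 0) (d : ℕ) : ¬ PC.RefutableInDegree 𝓕 d := by
  have key : ∀ f, PC.DerivableInDegree 𝓕 d f → bval x f = 0 := by
    intro f hf
    induction hf with
    | hyp hmem _ => exact hx _ hmem
    | booleanAxiom j _ =>
      have hX : bval x (X j : MvPolynomial ℕ K) = if x j then 1 else 0 := by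
        rw [bval, eval_X]; rfl
      rw [bval_sub, pow_two, bval_mul, hX]; split <;> simp
    | add _ _ ih₁ ih₂ => rw [bval_add, ih₁, ih₂, add_zero]
    | mul h _ _ ih => rw [bval_mul, ih, zero_mul]
  intro h
  have := key 1 h
  rw [bval_one] at this
  exact one_ne_zero this

/-- **Low-degree vacuity**: if every axiom has degree `> d` and `d < 2` (so the Boolean axioms are
out of reach too), nothing is derivable in degree `≤ d`. [Mikša–Nordström 2015, proof of Thm 3.6
("removing all axiom clauses … with degree strictly greater than …")] [cite: MiksaNordstrom2015, Theorem 3.6] -/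
theorem not_refutableInDegree_of_lt_totalDegree {𝓕 : Set (MvPolynomial ℕ K)} {d : ℕ}
    (h𝓕 : ∀ f ∈ 𝓕, d < f.totalDegree) (hd : d < 2) : ¬ PC.RefutableInDegree 𝓕 d := by
  have key : ∀ f, PC.DerivableInDegree 𝓕 d f → False := by
    intro f hf
    induction hf with
    | hyp hmem hdeg => exact absurd hdeg (not_le.2 (h𝓕 _ hmem))
    | booleanAxiom j hdeg =>
      have : ((X j : MvPolynomial ℕ K) ^ 2 - X j).totalDegree = 2 := by
        rw [sub_eq_add_neg, totalDegree_add_eq_left_of_totalDegree_lt]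
        · exact totalDegree_X_pow j 2
        · rw [totalDegree_neg, totalDegree_X, totalDegree_X_pow]; omega
      omega
    | add _ _ ih₁ _ => exact ih₁
    | mul _ _ _ ih => exact ih
  exact fun h => key 1 h

end PC

namespace FPHP

variable {m n : ℕ} (N : Fin m → Finset (Fin n))

/-! ### The structure `(𝓕, 𝒱)_E` of `FPHP_G` -/

/-- `𝓕`: the pigeon axioms as singleton subformulas. [Mikša–Nordström 2015, proof of Thm 4.9 ("We
define the family 𝓕 to consist of the pigeon axioms interpreted as singleton CNF formulas")]
[cite: MiksaNordstrom2015, Theorem 4.9] -/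
def fam : Fin m → CNF ℕ := fun u => [pigeonClause N u]

/-- `E`: the hole and functionality axioms. [Mikša–Nordström 2015, proof of Thm 4.9]
[cite: MiksaNordstrom2015, Theorem 4.9] -/
def fixedE : CNF ℕ := holeClauses N ++ functionalityClauses N

/-- `V_v = {x_{u',v'} : v ∈ N(u'), v' ∈ N(u')}`. [Mikša–Nordström 2015, proof of Thm 4.9, display
(4.12)] [cite: MiksaNordstrom2015, Theorem 4.9] -/
def vset : Fin n → Finset ℕ := fun v =>
  (Finset.univ.filter fun u' : Fin m => v ∈ N u').biUnion fun u' => (N u').image (var n u')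

variable {N}

/-- The variable `x_{u,v}` determines pigeon and hole. [Mikša–Nordström 2015, §4.2 (variables
`x_{u,v}`, `(u,v) ∈ E`)] [cite: MiksaNordstrom2015, §4.2] -/
theorem var_inj {u u' : Fin m} {v v' : Fin n} (h : var n u v = var n u' v') :
    u = u' ∧ v = v' := by
  unfold var at h
  have hv := v.isLt; have hv' := v'.isLt
  have hn : 0 < n := lt_of_le_of_lt (Nat.zero_le _) hv
  have hdiv : ∀ (x y : ℕ), y < n → (x * n + y) / n = x := fun x y hy => by
    rw [show x * n + y = y + x * n by ring, Nat.add_mul_div_right _ _ hn, Nat.div_eq_of_lt hy,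
      zero_add]
  have hmod : ∀ (x y : ℕ), y < n → (x * n + y) % n = y := fun x y hy => by
    rw [show x * n + y = y + x * n by ring, Nat.add_mul_mod_self_right, Nat.mod_eq_of_lt hy]
  have e1 := hdiv u v hv; rw [h, hdiv u' v' hv'] at e1
  have e2 := hmod u v hv; rw [h, hmod u' v' hv'] at e2
  exact ⟨Fin.ext e1.symm, Fin.ext e2.symm⟩

/-- Membership in `V_v`. [Mikša–Nordström 2015, (4.12)] [cite: MiksaNordstrom2015, Theorem 4.9] -/
theorem mem_vset {v : Fin n} {x : ℕ} :
    x ∈ vset N v ↔ ∃ u', v ∈ N u' ∧ ∃ v' ∈ N u', var n u' v' = x := by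
  simp [vset]

/-- `x_{u',v'} ∈ V_v` for `v, v' ∈ N(u')`. [Mikša–Nordström 2015, (4.12)] [cite: MiksaNordstrom2015, Theorem 4.9] -/
theorem var_mem_vset {u' : Fin m} {v v' : Fin n} (hv : v ∈ N u') (hv' : v' ∈ N u') :
    var n u' v' ∈ vset N v :=
  mem_vset.2 ⟨u', hv, v', hv', rfl⟩

/-- Membership in a pigeon axiom. [Mikša–Nordström 2015, (4.2a)] [cite: MiksaNordstrom2015, (4.2a)] -/
theorem mem_pigeonClause {u : Fin m} {l : Literal ℕ} :
    l ∈ pigeonClause N u ↔ ∃ v ∈ N u, (var n u v, true) = l := by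
  simp [pigeonClause]

/-- Membership in the hole axioms. [Mikša–Nordström 2015, (4.2b)] [cite: MiksaNordstrom2015, (4.2b)] -/
theorem mem_holeClauses {C : Clause ℕ} : C ∈ holeClauses N ↔
    ∃ v u u', u < u' ∧ v ∈ N u ∧ v ∈ N u' ∧ C = [(var n u v, false), (var n u' v, false)] := by
  simp only [holeClauses, List.mem_flatMap, List.mem_finRange, true_and]
  constructor
  · rintro ⟨v, u, u', h⟩
    refine ⟨v, u, u', ?_⟩
    split_ifs at h with hc
    · rw [List.mem_singleton] at h; exact ⟨hc.1, hc.2.1, hc.2.2, h⟩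
    · simp at h
  · rintro ⟨v, u, u', huu', hv, hv', rfl⟩
    exact ⟨v, u, u', by rw [if_pos ⟨huu', hv, hv'⟩]; exact List.mem_singleton.2 rfl⟩

/-- Membership in the functionality axioms. [Mikša–Nordström 2015, (4.2c)] [cite: MiksaNordstrom2015, (4.2c)] -/
theorem mem_functionalityClauses {C : Clause ℕ} : C ∈ functionalityClauses N ↔
    ∃ u v v', v < v' ∧ v ∈ N u ∧ v' ∈ N u ∧ C = [(var n u v, false), (var n u v', false)] := by
  simp only [functionalityClauses, List.mem_flatMap, List.mem_finRange, true_and]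
  constructor
  · rintro ⟨u, v, v', h⟩
    refine ⟨u, v, v', ?_⟩
    split_ifs at h with hc
    · rw [List.mem_singleton] at h; exact ⟨hc.1, hc.2.1, hc.2.2, h⟩
    · simp at h
  · rintro ⟨u, v, v', hvv', hv, hv', rfl⟩
    exact ⟨u, v, v', by rw [if_pos ⟨hvv', hv, hv'⟩]; exact List.mem_singleton.2 rfl⟩

/-- Every clause of `E` is a pair of negative literals `¬x_{u₁,v₁} ∨ ¬x_{u₂,v₂}` on edges.
[Mikša–Nordström 2015, (4.2b)–(4.2c)] [cite: MiksaNordstrom2015, §4.2] -/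
theorem exists_of_mem_fixedE {C : Clause ℕ} (hC : C ∈ fixedE N) :
    ∃ u₁ v₁ u₂ v₂, v₁ ∈ N u₁ ∧ v₂ ∈ N u₂ ∧ (u₁ = u₂ ∨ v₁ = v₂) ∧ (u₁, v₁) ≠ (u₂, v₂) ∧
      C = [(var n u₁ v₁, false), (var n u₂ v₂, false)] := by
  rcases List.mem_append.1 hC with h | h
  · obtain ⟨v, u, u', huu', hv, hv', rfl⟩ := mem_holeClauses.1 h
    exact ⟨u, v, u', v, hv, hv', Or.inr rfl, fun heq => huu'.ne (Prod.mk.inj heq).1, rfl⟩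
  · obtain ⟨u, v, v', hvv', hv, hv', rfl⟩ := mem_functionalityClauses.1 h
    exact ⟨u, v, u, v', hv, hv', Or.inl rfl, fun heq => hvv'.ne (Prod.mk.inj heq).2, rfl⟩

/-- Every `V_v` respects `E`: "setting all variables in `V_v` to false satisfies all clauses in `E`
mentioning variables in `V_v`". [Mikša–Nordström 2015, proof of Thm 4.9] [cite: MiksaNordstrom2015, Theorem 4.9] -/
theorem vset_respects (k : Fin n) : ∃ a, Respects (vset N k) a (fixedE N) := by
  refine ⟨fun _ => false, fun C hC ht => ?_⟩
  obtain ⟨l, hl, hlV⟩ := ht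
  obtain ⟨u₁, v₁, u₂, v₂, -, -, -, -, rfl⟩ := exists_of_mem_fixedE hC
  refine ⟨l, hl, hlV, ?_⟩
  simp only [List.mem_cons, List.not_mem_nil, or_false] at hl
  rcases hl with rfl | rfl <;> rfl

/-- `V_k` is a neighbour of `P^u` iff `k ∈ N(u)` ("`G` and `(𝓕, 𝒱)_E` share the same neighbourhood
structure"). [Mikša–Nordström 2015, proof of Thm 4.9] [cite: MiksaNordstrom2015, Theorem 4.9] -/
theorem isNbr_iff {u : Fin m} {k : Fin n} : IsNbr (fam N) (vset N) u k ↔ k ∈ N u := by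
  constructor
  · rintro ⟨C, hC, l, hl, hlV⟩
    rw [fam, List.mem_singleton] at hC
    subst hC
    obtain ⟨v, hv, rfl⟩ := mem_pigeonClause.1 hl
    obtain ⟨u', hk, v', hv', heq⟩ := mem_vset.1 hlV
    obtain ⟨rfl, -⟩ := var_inj heq
    exact hk
  · intro hk
    exact ⟨pigeonClause N u, by simp [fam], (var n u k, true), mem_pigeonClause.2 ⟨k, hk, rfl⟩,
      var_mem_vset hk hk⟩

/-- **Respectful neighbours**: if `k ∈ N(u)` then `V_k` respectfully satisfies `P^u` (send `u` to
`k` and set the remaining variables of `V_k` to false: every hole or functionality axiom containing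
`x_{u,k}` has its other variable in `V_k`). [Mikša–Nordström 2015, proof of Thm 4.9 (the assignment
`α_{u,v}`)] [cite: MiksaNordstrom2015, Theorem 4.9] -/
theorem isRespNbr_of_mem {u : Fin m} {k : Fin n} (hk : k ∈ N u) :
    IsRespNbr (fam N) (vset N) (fixedE N) u k := by
  classical
  refine ⟨isNbr_iff.2 hk, fun x => decide (x = var n u k), fun C hC => ?_, fun C hC ht => ?_⟩
  · rw [fam, List.mem_singleton] at hC
    subst hC
    exact ⟨(var n u k, true), mem_pigeonClause.2 ⟨k, hk, rfl⟩, var_mem_vset hk hk, by simp⟩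
  · obtain ⟨u₁, v₁, u₂, v₂, h₁, h₂, hshare, hne, rfl⟩ := exists_of_mem_fixedE hC
    -- a literal `(x, false)` of `C` with `x ∈ V_k`, `x ≠ x_{u,k}` does the job
    have goal : ∀ x, x ∈ vset N k → x ≠ var n u k →
        (x = var n u₁ v₁ ∨ x = var n u₂ v₂) →
        PSat (vset N k) (fun y => decide (y = var n u k))
          [(var n u₁ v₁, false), (var n u₂ v₂, false)] := by
      intro x hx hxne hxor
      refine ⟨(x, false), ?_, hx, by simp [hxne]⟩
      rcases hxor with rfl | rfl <;> simp
    by_cases e₁ : var n u₁ v₁ = var n u k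
    · -- the other variable is `x_{u₂,v₂}` with `u₂ = u` or `v₂ = k`: it lies in `V_k`
      obtain ⟨rfl, rfl⟩ := var_inj e₁
      refine goal (var n u₂ v₂) ?_ (fun e => hne ?_) (Or.inr rfl)
      · rcases hshare with rfl | rfl
        · exact var_mem_vset h₁ h₂
        · exact var_mem_vset h₂ h₂
      · obtain ⟨rfl, rfl⟩ := var_inj e; rfl
    by_cases e₂ : var n u₂ v₂ = var n u k
    · obtain ⟨rfl, rfl⟩ := var_inj e₂
      refine goal (var n u₁ v₁) ?_ e₁ (Or.inl rfl)
      rcases hshare with rfl | rfl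
      · exact var_mem_vset h₂ h₁
      · exact var_mem_vset h₁ h₁
    · obtain ⟨l, hl, hlV⟩ := ht
      simp only [List.mem_cons, List.not_mem_nil, or_false] at hl
      rcases hl with rfl | rfl
      · exact goal _ hlV e₁ (Or.inl rfl)
      · exact goal _ hlV e₂ (Or.inr rfl)

/-- Membership in a hole scope. [Mikša–Nordström 2015, Def. 4.1] [cite: MiksaNordstrom2015, Def. 4.1] -/
theorem mem_holeScope {u : Fin m} {x : ℕ} : x ∈ holeScope N u ↔ ∃ v ∈ N u, v.val = x := by
  simp [holeScope]

/-- **Boundary expansion transfers**: an `(s, δ)`-boundary expander `G` gives an `(s, δ, 0, E)`-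
respectful boundary expander `(𝓕, 𝒱)_E` ("the expansion parameters of `G` trivially carry over").
[Mikša–Nordström 2015, proof of Thm 4.9] [cite: MiksaNordstrom2015, Theorem 4.9] -/
theorem isRespExpander {s δ : ℝ} (hG : IsBoundaryExpander (holeScope N) s δ) :
    IsRespExpander (fam N) (vset N) (fixedE N) s δ 0 := by
  classical
  intro S hS
  rw [sub_zero]
  refine (hG S hS).trans ?_
  have hsub : boundary (holeScope N) S ⊆
      (respBoundary (fam N) (vset N) (fixedE N) S).map Fin.valEmbedding := by
    intro x hx
    obtain ⟨hcov, hdeg⟩ := mem_boundary.1 hx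
    obtain ⟨u, hu, hxu⟩ := mem_cover.1 hcov
    obtain ⟨k, hk, rfl⟩ := mem_holeScope.1 hxu
    rw [coverDegree, Finset.card_eq_one] at hdeg
    obtain ⟨u₀, hu₀⟩ := hdeg
    have huniq : ∀ u' ∈ S, k ∈ N u' → u' = u₀ := fun u' hu' hk' => by
      have : u' ∈ ({u₀} : Finset (Fin m)) := by
        rw [← hu₀]; exact Finset.mem_filter.2 ⟨hu', mem_holeScope.2 ⟨k, hk', rfl⟩⟩
      exact Finset.mem_singleton.1 this
    have hu0 : u = u₀ := huniq u hu hk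
    refine Finset.mem_map.2 ⟨k, mem_respBoundary.2 ⟨u, hu, isRespNbr_of_mem hk,
      fun u' hu' hne hn => hne ?_⟩, rfl⟩
    rw [huniq u' hu' (isNbr_iff.1 hn), hu0]
  exact_mod_cast (Finset.card_le_card hsub).trans (Finset.card_map _).le

/-- **Overlap**: every variable lies in at most `d` of the sets `V_v` when left degrees are `≤ d`
("`x_{u,v}` appears in `V_{v'}` only when `v' ∈ N(u)`"). [Mikša–Nordström 2015, proof of Thm 4.9]
[cite: MiksaNordstrom2015, Theorem 4.9] -/
theorem overlap_le {d : ℕ} (hdeg : ∀ u, (N u).card ≤ d) (x : ℕ) :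
    (Finset.univ.filter fun k => x ∈ vset N k).card ≤ d := by
  classical
  by_cases h : ∃ k, x ∈ vset N k
  · obtain ⟨k, hk⟩ := h
    obtain ⟨u', -, v', -, rfl⟩ := mem_vset.1 hk
    refine (Finset.card_le_card fun k' hk' => ?_).trans (hdeg u')
    obtain ⟨u'', hk'', v'', -, heq⟩ := mem_vset.1 (Finset.mem_filter.1 hk').2
    obtain ⟨rfl, -⟩ := var_inj heq
    exact hk''
  · push Not at h
    rw [Finset.filter_false_of_mem fun k _ => h k, Finset.card_empty]
    exact Nat.zero_le _

end FPHP

end Literature.Computability.MetaComplexity
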